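import Summits.HubbardSuperconductivity.HubbardSuperconductivity.Theorems.DeformationLadderLowEnergyRigidityTelescopeRigidityPhases
import Literature.MathematicalPhysics.QuantumLattice.ApproximateEigenvectorLemmas
import Literature.Analysis.FunctionSpaces.TorusDirichletKernelProofs

/-!
# Telescope rigidity, part 7: finite Fourier analysis on the torus for the converse direction

Route `DeformationLadder`, crux `LowEnergyRigidity` (item stmt-HubbardSuperconductivity-1892), line
`Sketch` (poincare-telescope). Support file (no definitions) preparing the converse of part 6
(infrared pair-momentum rigidity ⟹ top-scale cell rigidity):

* `rigc_phase_eq_conj_torusChar`: the pair-momentum phase of `TwistGap.TgPairMomentumRigidity` is the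
  conjugate torus character `conj χ_q(y)`;
* `rigc_fourier_inversion`: for vectors `u_x` and coefficients `g(x)`,
  `Σ_x g(x) u_x = L⁻² Σ_q ĝ(q) w_q` with `ĝ(q) = Σ_x g(x) χ_q(x)` and the modes `w_q = Σ_y conj χ_q(y) u_y`;
* `rigc_sum_eucNorm_mode_sq`: the vector sum rule `Σ_q ‖w_q‖² = L² Σ_x ‖u_x‖²`;
* one-dimensional characters: `rigc_sum_normSq_charSum` (Parseval for a finite set of residues:
  `Σ_{q ∈ ℤ/L} ‖Σ_{x ∈ I} e(q x)‖² = L |I|`), the geometric-sum form on an arithmetic progression and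
  its Dirichlet-kernel bound `‖Σ_{m<n} e(q (a+m))‖ ≤ L / (2 ‖q‖)` (`‖q‖ = min(q.val, L − q.val)`,
  `q ≠ 0`; `rigc_norm_charSum_progression_le`), and the tail sum `Σ_{‖q‖ > K} 1/‖q‖² ≤ 2/K`
  (`rigc_sum_inv_normSq_tail_le`).
[folklore]
-/

noncomputable section

namespace Summit.HubbardSuperconductivity.HubbardSuperconductivity.Theorems.LowEnergyRigidity.Telescope

set_option linter.dupNamespace false -- summit = problem name (single-conjunct summit), D-0017

open Matrix Literature.MathematicalPhysics.QuantumLattice Literature.Probability.LatticeModels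
open scoped ComplexConjugate ComplexOrder

/-! ### The pair-momentum phase is a conjugate character -/

/-- The phase `exp(−2πi (Σᵢ (q i).val (y i).val)/L)` of `TwistGap.TgPairMomentumRigidity` equals
`conj χ_q(y)`. [folklore] -/
theorem rigc_phase_eq_conj_torusChar (L : ℕ) [NeZero L] (q y : TorusSite 2 L) :
    Complex.exp (-(2 * (Real.pi : ℂ) * Complex.I / (L : ℂ)) * ((∑ i : Fin 2, (q i).val * (y i).val : ℕ) : ℂ)) =
      conj (torusChar q y) := by
  unfold torusChar
  simp_rw [stdAddChar_mul_eq_exp]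
  rw [← Complex.exp_sum, ← Complex.exp_conj, map_sum]
  congr 1
  push_cast
  rw [Finset.mul_sum]
  refine Finset.sum_congr rfl fun i _ => ?_
  simp only [map_div₀, map_mul, map_ofNat, Complex.conj_ofReal, Complex.conj_I, map_natCast]
  ring

/-! ### Fourier inversion and the sum rule for vector families -/

section Vectors

variable {n : Type*} [Fintype n]

omit [Fintype n] in
/-- **Fourier inversion for a vector family on `(ℤ/L)²`**:
`Σ_x g(x) u_x = (L²)⁻¹ Σ_q ĝ(q) w_q`, `ĝ(q) = Σ_x g(x) χ_q(x)`, `w_q = Σ_y conj χ_q(y) u_y`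
(orthogonality `Σ_q χ_q(x − y) = L² δ_{xy}`). [folklore] -/
theorem rigc_fourier_inversion (L : ℕ) [NeZero L] (g : TorusSite 2 L → ℂ) (u : TorusSite 2 L → n → ℂ) :
    ∑ x, g x • u x =
      ((L : ℂ) ^ 2)⁻¹ • ∑ q : TorusSite 2 L, (∑ x, g x * torusChar q x) • ∑ y, conj (torusChar q y) • u y := by
  classical
  have hL : ((L : ℂ) ^ 2) ≠ 0 := pow_ne_zero _ (Nat.cast_ne_zero.2 (NeZero.ne L))
  -- expand the right-hand side into a triple sum and use orthogonality in `q`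
  have hexp : ∑ q : TorusSite 2 L, (∑ x, g x * torusChar q x) • ∑ y, conj (torusChar q y) • u y =
      ∑ x, ∑ y, (g x * ∑ q : TorusSite 2 L, torusChar q (x - y)) • u y := by
    have h1 : ∀ q : TorusSite 2 L, (∑ x, g x * torusChar q x) • ∑ y, conj (torusChar q y) • u y =
        ∑ x, ∑ y, (g x * torusChar q (x - y)) • u y := by
      intro q
      rw [Finset.sum_smul]
      refine Finset.sum_congr rfl fun x _ => ?_
      rw [Finset.smul_sum]
      refine Finset.sum_congr rfl fun y _ => ?_
      rw [smul_smul, torusChar_sub_right, mul_assoc]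
    simp_rw [h1]
    rw [Finset.sum_comm]
    refine Finset.sum_congr rfl fun x _ => ?_
    rw [Finset.sum_comm]
    refine Finset.sum_congr rfl fun y _ => ?_
    rw [← Finset.sum_smul, ← Finset.mul_sum]
  rw [hexp]
  have horth : ∀ x y : TorusSite 2 L, ∑ q : TorusSite 2 L, torusChar q (x - y) =
      if x = y then (L : ℂ) ^ 2 else 0 := by
    intro x y
    rw [sum_torusChar_left]
    by_cases hxy : x = y
    · rw [if_pos (sub_eq_zero.mpr hxy), if_pos hxy]
    · rw [if_neg (sub_ne_zero.mpr hxy), if_neg hxy]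
  simp_rw [horth, mul_ite, mul_zero, ite_smul, zero_smul, Finset.sum_ite_eq, Finset.mem_univ, if_true]
  rw [Finset.smul_sum]
  refine Finset.sum_congr rfl fun x _ => ?_
  rw [smul_smul]
  congr 1
  have hL1 : (L : ℂ) ≠ 0 := Nat.cast_ne_zero.2 (NeZero.ne L)
  field_simp

/-- **Vector sum rule** (Plancherel): `Σ_q ‖w_q‖₂² = L² Σ_x ‖u_x‖₂²` for the modes
`w_q = Σ_y conj χ_q(y) u_y`. [folklore] -/
theorem rigc_sum_eucNorm_mode_sq (L : ℕ) [NeZero L] (u : TorusSite 2 L → n → ℂ) :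
    ∑ q : TorusSite 2 L, eucNorm (∑ y, conj (torusChar q y) • u y) ^ 2 = (L : ℝ) ^ 2 * ∑ x, eucNorm (u x) ^ 2 := by
  classical
  -- expand `‖w_q‖² = Σ_{x,y} χ_q(x) conj χ_q(y) ⟨u_x, u_y⟩` and sum over `q`
  have h1 : ∀ q : TorusSite 2 L, ((eucNorm (∑ y, conj (torusChar q y) • u y) ^ 2 : ℝ) : ℂ) =
      ∑ x, ∑ y, torusChar q (x - y) * (star (u x) ⬝ᵥ u y) := by
    intro q
    rw [← star_dotProduct_self_eq_eucNorm_sq, star_sum, sum_dotProduct]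
    refine Finset.sum_congr rfl fun x _ => ?_
    rw [dotProduct_sum]
    refine Finset.sum_congr rfl fun y _ => ?_
    rw [star_smul, smul_dotProduct, dotProduct_smul, smul_eq_mul, smul_eq_mul, Complex.star_def,
      Complex.conj_conj, torusChar_sub_right]
    ring
  have h2 : ((∑ q : TorusSite 2 L, eucNorm (∑ y, conj (torusChar q y) • u y) ^ 2 : ℝ) : ℂ) =
      (((L : ℝ) ^ 2 * ∑ x, eucNorm (u x) ^ 2 : ℝ) : ℂ) := by
    rw [Complex.ofReal_sum]
    simp_rw [h1]
    rw [Finset.sum_comm]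
    have h3 : ∀ x : TorusSite 2 L, ∑ q : TorusSite 2 L, ∑ y, torusChar q (x - y) * (star (u x) ⬝ᵥ u y) =
        (L : ℂ) ^ 2 * (star (u x) ⬝ᵥ u x) := by
      intro x
      rw [Finset.sum_comm]
      have h4 : ∀ y, ∑ q : TorusSite 2 L, torusChar q (x - y) * (star (u x) ⬝ᵥ u y) =
          (if x = y then (L : ℂ) ^ 2 else 0) * (star (u x) ⬝ᵥ u y) := by
        intro y
        rw [← Finset.sum_mul, sum_torusChar_left]
        by_cases hxy : x = y
        · rw [if_pos (sub_eq_zero.mpr hxy), if_pos hxy]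
        · rw [if_neg (sub_ne_zero.mpr hxy), if_neg hxy]
      simp_rw [h4, ite_mul, zero_mul, Finset.sum_ite_eq, Finset.mem_univ, if_true]
    simp_rw [h3]
    rw [← Finset.mul_sum]
    push_cast
    congr 1
    refine Finset.sum_congr rfl fun x _ => ?_
    rw [star_dotProduct_self_eq_eucNorm_sq]
    push_cast
    ring
  exact_mod_cast h2

end Vectors

/-! ### One-dimensional characters: Parseval on a set of residues, progressions, tails -/

/-- **Parseval for a finite set of residues**: `Σ_{q ∈ ℤ/L} ‖Σ_{x ∈ I} e(q·x)‖² = L · |I|`. [folklore] -/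
theorem rigc_sum_normSq_charSum (L : ℕ) [NeZero L] (I : Finset (ZMod L)) :
    ∑ q : ZMod L, ‖∑ x ∈ I, (ZMod.stdAddChar (q * x) : ℂ)‖ ^ 2 = (L : ℝ) * I.card := by
  classical
  have h1 : ∀ q : ZMod L, ((‖∑ x ∈ I, (ZMod.stdAddChar (q * x) : ℂ)‖ ^ 2 : ℝ) : ℂ) =
      ∑ x ∈ I, ∑ y ∈ I, (ZMod.stdAddChar (q * (x - y)) : ℂ) := by
    intro q
    rw [← Complex.normSq_eq_norm_sq, Complex.normSq_eq_conj_mul_self, map_sum, Finset.sum_mul_sum,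
      Finset.sum_comm]
    refine Finset.sum_congr rfl fun x _ => Finset.sum_congr rfl fun y _ => ?_
    rw [mul_sub, sub_eq_add_neg, AddChar.map_add_eq_mul, AddChar.map_neg_eq_conj, mul_comm]
  have h2 : ((∑ q : ZMod L, ‖∑ x ∈ I, (ZMod.stdAddChar (q * x) : ℂ)‖ ^ 2 : ℝ) : ℂ) = (((L : ℝ) * I.card : ℝ) : ℂ) := by
    rw [Complex.ofReal_sum]
    simp_rw [h1]
    rw [Finset.sum_comm]
    have h3 : ∀ x ∈ I, ∑ q : ZMod L, ∑ y ∈ I, (ZMod.stdAddChar (q * (x - y)) : ℂ) = (L : ℂ) := by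
      intro x hx
      rw [Finset.sum_comm]
      have h4 : ∀ y, ∑ q : ZMod L, (ZMod.stdAddChar (q * (x - y)) : ℂ) = if x - y = 0 then (L : ℂ) else 0 := by
        intro y
        rw [AddChar.sum_mulShift (x - y) (ZMod.isPrimitive_stdAddChar L), ZMod.card, Nat.cast_ite, Nat.cast_zero]
      simp_rw [h4, sub_eq_zero]
      rw [Finset.sum_ite_eq, if_pos hx]
    rw [Finset.sum_congr rfl h3, Finset.sum_const, nsmul_eq_mul, mul_comm]
    push_cast
    ring
  exact_mod_cast h2

/-- A character sum over an arithmetic progression of residues is a geometric sum: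
`Σ_{m<n} e(q (a+m)) = e(q a) Σ_{m<n} e(q)^m`. [folklore] -/
theorem rigc_charSum_progression (L : ℕ) [NeZero L] (q : ZMod L) (a n : ℕ) :
    ∑ m ∈ Finset.range n, (ZMod.stdAddChar (q * ((a + m : ℕ) : ZMod L)) : ℂ) =
      (ZMod.stdAddChar (q * (a : ZMod L)) : ℂ) * ∑ m ∈ Finset.range n, (ZMod.stdAddChar q : ℂ) ^ m := by
  rw [Finset.mul_sum]
  refine Finset.sum_congr rfl fun m _ => ?_
  rw [Nat.cast_add, mul_add, AddChar.map_add_eq_mul]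
  congr 1
  rw [show q * ((m : ℕ) : ZMod L) = m • q by rw [nsmul_eq_mul, mul_comm], AddChar.map_nsmul_eq_pow]

/-- The standard character value as an exponential of the representative:
`e(q) = exp(i · 2π (q.val/L))`. [folklore] -/
theorem rigc_stdAddChar_eq_exp (L : ℕ) [NeZero L] (q : ZMod L) :
    (ZMod.stdAddChar q : ℂ) = Complex.exp (Complex.I * ((2 * Real.pi * ((q.val : ℝ) / L) : ℝ) : ℂ)) := by
  rw [ZMod.stdAddChar_apply, ZMod.toCircle_apply]
  congr 1
  push_cast
  ring

/-- **Jordan on the torus**: for `q ≠ 0` in `ℤ/L`, `2 ‖q‖ / L ≤ |sin(π q.val / L)|` with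
`‖q‖ = min(q.val, L − q.val)`. [folklore] -/
theorem rigc_sin_ge (L : ℕ) [NeZero L] (q : ZMod L) :
    2 * ((min q.val (L - q.val) : ℕ) : ℝ) / L ≤ |Real.sin (Real.pi * ((q.val : ℝ) / L))| := by
  have hL : (0 : ℝ) < L := Nat.cast_pos.mpr (Nat.pos_of_ne_zero (NeZero.ne L))
  have hlt : q.val < L := ZMod.val_lt q
  rcases le_or_gt (2 * q.val) L with h | h
  · -- `q.val ≤ L/2`: Jordan at `y = q.val / L`
    have hy : |(q.val : ℝ) / L| ≤ 1 / 2 := by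
      rw [abs_of_nonneg (by positivity), div_le_iff₀ hL]
      have : (2 * q.val : ℕ) ≤ L := h
      have : (2 : ℝ) * q.val ≤ L := by exact_mod_cast this
      linarith
    have hj := Literature.Analysis.FunctionSpaces.Torus.two_mul_abs_le_abs_sin_pi_mul hy
    rw [abs_of_nonneg (by positivity : (0 : ℝ) ≤ (q.val : ℝ) / L)] at hj
    refine le_trans ?_ hj
    rw [div_le_iff₀ hL]
    have : ((min q.val (L - q.val) : ℕ) : ℝ) ≤ q.val := by exact_mod_cast min_le_left _ _
    have h2 : 2 * ((q.val : ℝ) / L) * L = 2 * q.val := by field_simp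
    rw [h2]
    linarith
  · -- `q.val > L/2`: Jordan at `y = (L − q.val)/L`, `sin(π q.val/L) = sin(π (L − q.val)/L)`
    have hy : |((L - q.val : ℕ) : ℝ) / L| ≤ 1 / 2 := by
      rw [abs_of_nonneg (by positivity), div_le_iff₀ hL, Nat.cast_sub hlt.le]
      have : (L : ℝ) < 2 * q.val := by exact_mod_cast h
      linarith
    have hj := Literature.Analysis.FunctionSpaces.Torus.two_mul_abs_le_abs_sin_pi_mul hy
    rw [abs_of_nonneg (by positivity : (0 : ℝ) ≤ ((L - q.val : ℕ) : ℝ) / L)] at hj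
    have hsin : Real.sin (Real.pi * (((L - q.val : ℕ) : ℝ) / L)) = Real.sin (Real.pi * ((q.val : ℝ) / L)) := by
      rw [Nat.cast_sub hlt.le, sub_div, div_self hL.ne', mul_sub, mul_one, Real.sin_pi_sub]
    rw [hsin] at hj
    refine le_trans ?_ hj
    rw [div_le_iff₀ hL]
    have : ((min q.val (L - q.val) : ℕ) : ℝ) ≤ ((L - q.val : ℕ) : ℝ) := by exact_mod_cast min_le_right _ _
    have h2 : 2 * (((L - q.val : ℕ) : ℝ) / L) * L = 2 * ((L - q.val : ℕ) : ℝ) := by field_simp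
    rw [h2]
    linarith

/-- **Dirichlet-kernel bound for a progression**: for `q ≠ 0` in `ℤ/L` and any `a`, `n`,
`‖Σ_{m<n} e(q (a+m))‖ ≤ L / (2 ‖q‖)`, `‖q‖ = min(q.val, L − q.val) ≥ 1`
(geometric sum `≤ 1/|sin(π q.val/L)|` and Jordan). [folklore] -/
theorem rigc_norm_charSum_progression_le (L : ℕ) [NeZero L] {q : ZMod L} (hq : q ≠ 0) (a n : ℕ) :
    ‖∑ m ∈ Finset.range n, (ZMod.stdAddChar (q * ((a + m : ℕ) : ZMod L)) : ℂ)‖ ≤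
      (L : ℝ) / (2 * ((min q.val (L - q.val) : ℕ) : ℝ)) := by
  have hL : (0 : ℝ) < L := Nat.cast_pos.mpr (Nat.pos_of_ne_zero (NeZero.ne L))
  have hlt : q.val < L := ZMod.val_lt q
  have hq0 : 0 < q.val := Nat.pos_of_ne_zero fun h => hq ((ZMod.val_eq_zero q).mp h)
  have hmpos : 0 < ((min q.val (L - q.val) : ℕ) : ℝ) := by
    have : 0 < min q.val (L - q.val) := lt_min hq0 (by omega)
    exact_mod_cast this
  rw [rigc_charSum_progression, norm_mul, AddChar.norm_apply, one_mul]
  simp_rw [rigc_stdAddChar_eq_exp L q]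
  -- `sin(π q.val/L) ≠ 0`
  have hsin := rigc_sin_ge L q
  have hsin0 : Real.sin (Real.pi * ((q.val : ℝ) / L)) ≠ 0 := by
    intro h0
    rw [h0, abs_zero] at hsin
    have : 0 < 2 * ((min q.val (L - q.val) : ℕ) : ℝ) / L := by positivity
    linarith
  refine (Literature.Analysis.FunctionSpaces.Torus.norm_circleGeomSum_le_inv_abs_sin hsin0 n).trans ?_
  rw [div_le_div_iff₀ (abs_pos.mpr hsin0) (by positivity), one_mul]
  have := mul_le_mul_of_nonneg_left hsin hL.le
  rw [mul_div_cancel₀ _ hL.ne'] at this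
  linarith

/-- **Tail of `Σ 1/j²`**: `Σ_{j = K+1}^{N} 1/j² ≤ 1/K` for `K ≥ 1` (`1/j² ≤ 1/(j−1) − 1/j`). [folklore] -/
theorem rigc_sum_Ioc_inv_sq_le {K : ℕ} (hK : 1 ≤ K) (N : ℕ) :
    ∑ j ∈ Finset.Ioc K N, (1 : ℝ) / (j : ℝ) ^ 2 ≤ 1 / K := by
  -- telescoping majorant `Σ_{K < j ≤ M} 1/j² ≤ 1/K − 1/M` for `K ≤ M`
  have hmaj : ∀ M : ℕ, K ≤ M → ∑ j ∈ Finset.Ioc K M, (1 : ℝ) / (j : ℝ) ^ 2 ≤ 1 / K - 1 / M := by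
    intro M hM
    induction M with
    | zero => exact absurd hM (by omega)
    | succ M ihM =>
      rcases Nat.eq_or_lt_of_le hM with h1 | h1
      · rw [← h1]; simp
      · have hKM : K ≤ M := by omega
        rw [Finset.sum_Ioc_succ_top hKM]
        have h2 := ihM hKM
        have hMpos : (0 : ℝ) < M := by exact_mod_cast (by omega : 0 < M)
        have h3 : (1 : ℝ) / ((M + 1 : ℕ) : ℝ) ^ 2 ≤ 1 / M - 1 / ((M + 1 : ℕ) : ℝ) := by
          rw [div_sub_div _ _ hMpos.ne' (by positivity), div_le_div_iff₀ (by positivity) (by positivity)]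
          push_cast
          nlinarith
        linarith
  rcases le_or_gt K N with hKN | hKN
  · have h4 := hmaj N hKN
    have h5 : (0 : ℝ) ≤ 1 / (N : ℝ) := by positivity
    linarith
  · rw [Finset.Ioc_eq_empty (by omega), Finset.sum_empty]
    positivity

/-- **Tail sum over the torus**: `Σ_{q ∈ ℤ/L, ‖q‖ > K} 1/‖q‖² ≤ 2/K` for `K ≥ 1`
(`‖q‖ = min(q.val, L − q.val)`; each value of `‖q‖` is taken at most twice). [folklore] -/
theorem rigc_sum_inv_normSq_tail_le (L : ℕ) [NeZero L] {K : ℕ} (hK : 1 ≤ K) :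
    ∑ q ∈ Finset.univ.filter (fun q : ZMod L => K < min q.val (L - q.val)),
        (1 : ℝ) / (((min q.val (L - q.val) : ℕ) : ℝ)) ^ 2 ≤ 2 / K := by
  classical
  -- split according to `2 q.val ≤ L` (then `‖q‖ = q.val`) or not (then `‖q‖ = L − q.val`)
  set S := Finset.univ.filter (fun q : ZMod L => K < min q.val (L - q.val)) with hS
  set S₁ := S.filter (fun q : ZMod L => 2 * q.val ≤ L) with hS₁
  set S₂ := S.filter (fun q : ZMod L => ¬ 2 * q.val ≤ L) with hS₂
  have hsplit := (Finset.sum_filter_add_sum_filter_not S (fun q : ZMod L => 2 * q.val ≤ L)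
    (fun q => (1 : ℝ) / (((min q.val (L - q.val) : ℕ) : ℝ)) ^ 2)).symm
  rw [hsplit]
  -- first part: inject by `q ↦ q.val` into `Ioc K L`
  have h1 : ∑ q ∈ S₁, (1 : ℝ) / (((min q.val (L - q.val) : ℕ) : ℝ)) ^ 2 ≤ ∑ j ∈ Finset.Ioc K L, (1 : ℝ) / (j : ℝ) ^ 2 := by
    have heq : ∀ q ∈ S₁, (1 : ℝ) / (((min q.val (L - q.val) : ℕ) : ℝ)) ^ 2 = (1 : ℝ) / ((q.val : ℕ) : ℝ) ^ 2 := by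
      intro q hq
      rw [hS₁, Finset.mem_filter] at hq
      rw [min_eq_left (by omega)]
    rw [Finset.sum_congr rfl heq]
    have hinj : Set.InjOn (fun q : ZMod L => q.val) S₁ := fun a _ b _ h => ZMod.val_injective L h
    have hmaps : ∀ q ∈ S₁, q.val ∈ Finset.Ioc K L := by
      intro q hq
      rw [hS₁, Finset.mem_filter, hS, Finset.mem_filter] at hq
      rw [Finset.mem_Ioc]
      exact ⟨lt_of_lt_of_le hq.1.2 (min_le_left _ _), (ZMod.val_lt q).le⟩
    calc ∑ q ∈ S₁, (1 : ℝ) / ((q.val : ℕ) : ℝ) ^ 2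
        = ∑ j ∈ S₁.image (fun q : ZMod L => q.val), (1 : ℝ) / (j : ℝ) ^ 2 := by
          rw [Finset.sum_image hinj]
      _ ≤ ∑ j ∈ Finset.Ioc K L, (1 : ℝ) / (j : ℝ) ^ 2 :=
          Finset.sum_le_sum_of_subset_of_nonneg (Finset.image_subset_iff.mpr hmaps)
            (fun j _ _ => by positivity)
  -- second part: inject by `q ↦ L − q.val` into `Ioc K L`
  have h2 : ∑ q ∈ S₂, (1 : ℝ) / (((min q.val (L - q.val) : ℕ) : ℝ)) ^ 2 ≤ ∑ j ∈ Finset.Ioc K L, (1 : ℝ) / (j : ℝ) ^ 2 := by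
    have heq : ∀ q ∈ S₂, (1 : ℝ) / (((min q.val (L - q.val) : ℕ) : ℝ)) ^ 2 = (1 : ℝ) / ((L - q.val : ℕ) : ℝ) ^ 2 := by
      intro q hq
      rw [hS₂, Finset.mem_filter] at hq
      rw [min_eq_right (by omega)]
    rw [Finset.sum_congr rfl heq]
    have hinj : Set.InjOn (fun q : ZMod L => L - q.val) S₂ := by
      intro a ha b hb h
      have ha' := ZMod.val_lt a
      have hb' := ZMod.val_lt b
      apply ZMod.val_injective L
      simp only at h
      omega
    have hmaps : ∀ q ∈ S₂, L - q.val ∈ Finset.Ioc K L := by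
      intro q hq
      rw [hS₂, Finset.mem_filter, hS, Finset.mem_filter] at hq
      rw [Finset.mem_Ioc]
      exact ⟨lt_of_lt_of_le hq.1.2 (min_le_right _ _), Nat.sub_le _ _⟩
    calc ∑ q ∈ S₂, (1 : ℝ) / ((L - q.val : ℕ) : ℝ) ^ 2
        = ∑ j ∈ S₂.image (fun q : ZMod L => L - q.val), (1 : ℝ) / (j : ℝ) ^ 2 := by
          rw [Finset.sum_image hinj]
      _ ≤ ∑ j ∈ Finset.Ioc K L, (1 : ℝ) / (j : ℝ) ^ 2 :=
          Finset.sum_le_sum_of_subset_of_nonneg (Finset.image_subset_iff.mpr hmaps)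
            (fun j _ _ => by positivity)
  have h3 := rigc_sum_Ioc_inv_sq_le hK L
  have h4 : (2 : ℝ) / K = 1 / K + 1 / K := by ring
  rw [h4]
  exact add_le_add (h1.trans h3) (h2.trans h3)

/-- **Tail sum over the torus, registered form** (all binders after the colon): the statement of
`rigc_sum_inv_normSq_tail_le`. [folklore] -/
theorem rigc_torus_tail : ∀ (L : ℕ) [NeZero L] (K : ℕ), 1 ≤ K → ∑ q ∈ Finset.univ.filter (fun q : ZMod L => K < min q.val (L - q.val)), (1 : ℝ) / (((min q.val (L - q.val) : ℕ) : ℝ)) ^ 2 ≤ 2 / K :=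
  fun L _ _ hK => rigc_sum_inv_normSq_tail_le L hK

end Summit.HubbardSuperconductivity.HubbardSuperconductivity.Theorems.LowEnergyRigidity.Telescope
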